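import Summits.QuantumFields.BalabanUV.Beta.GAN24.DressedHalfVertex
import Summits.QuantumFields.BalabanUV.Beta.GAN24.HarmonicPeriodicTwoForm
import Summits.QuantumFields.BalabanUV.Beta.GAN24.ResolventLegCharges

/-!
# `BalabanUV.Beta.GAN24.ExitFaceCurrentCellTotals` — binder row G-an2-4 ∕ (CONV-C), W-slot CT-W, conservation law (C)∕(C)sym AT LEVELS `j ≥ 1`, hypothesis (Z) of 24_j
# (`VHWordsZeroLatticeStep`), the GENERIC HALF: **THE CELL TOTALS OF A BOND-RESUMMED EXIT-FACE CURRENT VANISH WHENEVER THE TABLE's FACE-SUMMED SLOT SPLITS INTO A CONSTANT-SLOT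
# SUM PLUS A VALUE-HESSIAN COMMUTATOR, THE CONSTANT (SLOT + SECOND-LEG) SUM VANISHES, AND THE HESSIAN KILLS CONSTANTS AND EXIT FACES AND IS CELL-ADJOINT** — every input an
# explicit hypothesis on an abstract local, fine-covariant stencil family `S` and an abstract kernel entry `E`; the instance (the value-function cubic sector at the Ward pins: leaf-06
# g52's `ExitFaceHalfVertexSplit.faceSlot_e3OfK_split_sawtooth`, my g63 S3C-REC `ThreeFaceRecClosed.hasSum_unitS_SpureRecAt` (iii), leaf-06's `ValueHessianLinearGauge` ∕
# `ValueHessianCellAdjoint`) is a separate file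

NOT IN PRINT; OUR BOOKKEEPING ([folklore] `tsum` bookkeeping BY NAME over 6 `DressedHalfVertex.hasSum_vertexOfK_dressedStep` (the bond resummation = face-summed slot, every `j`,
any local `S`), g64 `HarmonicPeriodicTwoForm.sum_box_shift`, an5∕an2's `ExpKernelCalculus` (`summable_exp_shift′`, `tsum_exp_shift′`), `ResolventLegCharges.summable_exp_coarse′`;
G-an2-4 formalisation swarm, leaf prover `b2b-balaban-gan24-formalise-leaf-04`, gen 68).  HONEST FRAMING (cell contract, verbatim): «discharging `BetaPertH` makes Bałaban's UV
stability UNCONDITIONAL — a real constructive-QFT result; it is NOT the continuum limit and NOT the Clay problem.»  HONEST DEPENDENCY (verbatim): «continuum YM on T⁴ ⇐ BetaPertH ∧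
nine spine estimates (0/9 proved); BetaPertH ⇐ (D1) ∧ (D4) ∧ CAP+tail; G-an2-4 gates asym, D1 and NE2/3/4.»

WHY (journal R-leaf04-g68-1: at level 1 the cell totals are 1.1e-15 numerically; route in W-leaf04-g68-1).  With `T(b,z) = Σ'_{(u′,w)} χ_β(w)·vertexOfK X̃♮_J Lc S ν u′ z w (inl b)(inl β)`:
(1) Fubini + 6: `T(b,z) = c_J·Σ'_w χ_β(w)·Σ'_t χ_ν(t)·S ν t z w (inl b)(inl β)`; (2) the split `Σ'_t χ_ν(t)·S ν t z w = Lc⁻¹·A(z,w) − (2Lc)⁻¹·E(z,w)·(λ(w) − λ(z))`, `A(z,w) = Σ'_t S ν t z w`;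
(3) `Σ_{z∈cell} Σ'_w χ_β(w)·A(z,w) = (Σ_{cell} χ_β)·Σ'_{(t,w)} S ν t 0 w = 0` — fine covariance makes `A(z,w) = A(0, w − z)`, the cell sum of a shifted periodic weight does not depend on the shift,
and the (slot + second leg) constant sum vanishes; (4) `Σ_{z∈cell} Σ'_w E(z,w)·χ_β(w)λ(w) = Σ_{r∈cell} χ_β(r)λ(r)·Σ'_x E(x,r) = 0` (cell adjointness, `E` kills constants) and
`Σ'_w E(z,w)·χ_β(w) = 0` (`E` kills the exit face).

WHAT ([folklore]; generic `d`, blocking `Lc` with `[NeZero Lc]`; 0 `def`, 0 cited facts, 0 `def … : Prop`, 0 sorry): §1 `summable_prod_weight_vertexFamily`, `tsum_prod_weight_eq_iterated`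
(the pair sum over `(u′, w)` is the iterated sum `Σ'_w Σ'_{u′}`), **`tsum_weight_current_eq_faceSlot`** (step (1), in-block root, every `J`, all units, any local `S`); §2
`summable_prod_slot_leg`, `summable_slotSum_shift`, `slotSum_translate`, **`sum_box_tsum_face_slotSum_eq_zero`** (step (3)); §3 **`sum_box_faceSlot_current_eq_zero`** (steps (2)–(4):
the cell totals of `z ↦ Σ'_w χ_β(w)·Σ'_t χ_ν(t)·S ν t z w (inl b)(inl β)` vanish under the displayed hypotheses `hsplit`, `hS3`, `hErow`, `hEface`, `hEcol`, `hEadj`).  Asserts NO value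
of Bałaban's tables; discharges NOTHING of (C)sym ∕ (Q-D) ∕ (Q-D-rate) ∕ «T2Shape» ∕ «T2Drift» ∕ (hW, hWall); NEVER «G-an2-4 closed» as (CONV-C); NOT D1, NOT `BetaPertH`, NOT
continuum, NOT Clay.  2026-08-23; no existing file touched.
-/

noncomputable section

open Finset
open scoped BigOperators
open Literature.MathematicalPhysics.QuantumFieldTheory
open Literature.MathematicalPhysics.QuantumFieldTheory.Balaban1983to89
open Literature.MathematicalPhysics.QuantumFieldTheory.Balaban1983to89.Beta
open B12Sec2to5 (l1 l1_nonneg)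
open ExpKernelCalculus (Site MKer shiftK Decays BiLoc VertexFamily Zl summable_exp_shift' tsum_exp_shift' l1_sub_symm)
open OneStepResolventKernel (Fib LocStencil decays_mono biLoc_mono)
open OneStepKernelFamily (KInvStep vertexOfK vertexFamily_vertexOfK decays_KInvStep)
open AffineAveraging (box toSite)
open PeriodicDescent (IsPeriodic)
open Summit.QuantumFields.BalabanUV.Beta.AxialDressingRooted (coDressKBmAt decays_coDressKBmAt)
open Summit.QuantumFields.BalabanUV.Beta.HessKerDressedUnits (unitK decays_unitK)
open Summit.QuantumFields.BalabanUV.Beta.GAN24.DressedHalfVertex (hasSum_vertexOfK_dressedStep)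
open Summit.QuantumFields.BalabanUV.Beta.GAN24.HarmonicPeriodicTwoForm (sum_box_shift)
open Summit.QuantumFields.BalabanUV.Beta.GAN24.ResolventLegCharges (summable_exp_coarse')

namespace Summit.QuantumFields.BalabanUV.Beta.GAN24.ExitFaceCurrentCellTotals

variable {d : ℕ} {Lc : ℕ} [NeZero Lc]

/-! ## §1 The bond-resummed current is the face-summed slot (Fubini + 6) -/

section Resum

omit [NeZero Lc] in
/-- [folklore] **THE `(bond, leg)` FAMILY OF A VERTEX FAMILY AGAINST A BOUNDED LEG WEIGHT IS SUMMABLE**: `|ρ| ≤ 1`, `Q` a vertex family at a positive rate ⟹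
`Summable ((u′,w) ↦ ρ(w)·Q ν u′ z w f g)`. -/
theorem summable_prod_weight_vertexFamily (hLc : 1 ≤ Lc) {Q : Fin (d + 1) → Site (d + 1) → MKer (d + 1) (Fib d)} {Cv δ : ℝ} (hQ : VertexFamily Q Lc Cv δ) (hδ : 0 < δ)
    {ρ : Site (d + 1) → ℝ} (hρ : ∀ w, |ρ w| ≤ 1) (ν : Fin (d + 1)) (z : Site (d + 1)) (f g : Fib d) :
    Summable fun uw : Site (d + 1) × Site (d + 1) => ρ uw.2 * Q ν uw.1 z uw.2 f g := by
  have hCv0 : 0 ≤ Cv := (hQ ν 0).nonneg f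
  set M : Site (d + 1) × Site (d + 1) → ℝ := fun uw =>
    Cv * Real.exp (-δ * l1 (z - (Lc : ℤ) • uw.1)) * Real.exp (-δ * l1 (uw.2 - (Lc : ℤ) • uw.1)) with hM
  have hM0 : 0 ≤ M := fun uw => by positivity
  have hMs : Summable M := by
    refine (summable_prod_of_nonneg hM0).2 ⟨fun u' => ?_, ?_⟩
    · exact (summable_exp_shift' hδ ((Lc : ℤ) • u')).mul_left (Cv * Real.exp (-δ * l1 (z - (Lc : ℤ) • u')))
    · have e : ∀ u' : Site (d + 1), ∑' w : Site (d + 1), M (u', w) = Cv * Real.exp (-δ * l1 (z - (Lc : ℤ) • u')) * Zl (d + 1) δ := by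
        intro u'
        simp only [hM]
        rw [tsum_mul_left, tsum_exp_shift']
      refine (((summable_exp_coarse' (d := d) hLc hδ z).mul_left Cv).mul_right (Zl (d + 1) δ)).congr fun u' => ?_
      rw [e]
  refine Summable.of_norm_bounded hMs (fun uw => ?_)
  rw [Real.norm_eq_abs, abs_mul]
  have h2 := hQ ν uw.1 z uw.2 f g
  rw [mul_add, Real.exp_add, ← mul_assoc] at h2
  calc |ρ uw.2| * |Q ν uw.1 z uw.2 f g| ≤ 1 * M uw := mul_le_mul (hρ uw.2) h2 (abs_nonneg _) zero_le_one
    _ = M uw := one_mul _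

omit [NeZero Lc] in
/-- [folklore] **THE PAIR SUM IS THE ITERATED SUM WITH THE LEG OUTSIDE**: `Σ'_{(u′,w)} ρ(w)·Q ν u′ z w f g = Σ'_w ρ(w)·Σ'_{u′} Q ν u′ z w f g`. -/
theorem tsum_prod_weight_eq_iterated (hLc : 1 ≤ Lc) {Q : Fin (d + 1) → Site (d + 1) → MKer (d + 1) (Fib d)} {Cv δ : ℝ} (hQ : VertexFamily Q Lc Cv δ) (hδ : 0 < δ)
    {ρ : Site (d + 1) → ℝ} (hρ : ∀ w, |ρ w| ≤ 1) (ν : Fin (d + 1)) (z : Site (d + 1)) (f g : Fib d) :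
    ∑' uw : Site (d + 1) × Site (d + 1), ρ uw.2 * Q ν uw.1 z uw.2 f g = ∑' w : Site (d + 1), ρ w * ∑' u' : Site (d + 1), Q ν u' z w f g := by
  have hs := summable_prod_weight_vertexFamily hLc hQ hδ hρ ν z f g
  have hs' : Summable fun wu : Site (d + 1) × Site (d + 1) => ρ wu.1 * Q ν wu.2 z wu.1 f g :=
    ((Equiv.prodComm (Site (d + 1)) (Site (d + 1))).summable_iff.2 hs).congr fun wu => by simp
  rw [← (Equiv.prodComm (Site (d + 1)) (Site (d + 1))).tsum_eq (fun uw : Site (d + 1) × Site (d + 1) => ρ uw.2 * Q ν uw.1 z uw.2 f g)]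
  simp only [Equiv.prodComm_apply, Prod.fst_swap, Prod.snd_swap]
  rw [hs'.tsum_prod]
  refine tsum_congr fun w => ?_
  show ∑' u' : Site (d + 1), ρ w * Q ν u' z w f g = ρ w * ∑' u' : Site (d + 1), Q ν u' z w f g
  exact tsum_mul_left

/-- [folklore] **THE BOND-RESUMMED CURRENT OF THE CHAIN-RULE VERTEX OVER ANY LOCAL TABLE THROUGH THE DRESSED STEP KERNEL IS THE FACE-SUMMED SLOT** (in-block root, `1 ≤ Lc`,
every `J`, all units, `|ρ| ≤ 1`): `Σ'_{(u′,w)} ρ(w)·vertexOfK X̃♮_J Lc S ν u′ z w f g = c_J·Σ'_w ρ(w)·Σ'_t χ_ν(t)·S ν t z w f g`, `c_J = (Lc·s_m s_f)·((Lc^{J+1})^{d+2})⁻¹` (6 inside the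
iterated sum). -/
theorem tsum_weight_current_eq_faceSlot {r : Fin (d + 1) → ℕ} (hLc : 1 ≤ Lc) (hr : r ∈ box (d + 1) Lc) (sf sm : ℝ) (J : ℕ)
    {S : Fin (d + 1) → Site (d + 1) → MKer (d + 1) (Fib d)} {Cs δs : ℝ} (hS : LocStencil S Cs δs) (hδs : 0 < δs)
    {ρ : Site (d + 1) → ℝ} (hρ : ∀ w, |ρ w| ≤ 1) (ν : Fin (d + 1)) (z : Site (d + 1)) (f g : Fib d) :
    ∑' uw : Site (d + 1) × Site (d + 1), ρ uw.2 * vertexOfK (unitK sf sm (coDressKBmAt (toSite r) Lc (KInvStep (d := d) Lc J))) Lc S ν uw.1 z uw.2 f g =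
      (((Lc : ℝ) * (sm * sf)) * ((((Lc ^ (J + 1) : ℕ) : ℝ)) ^ (d + 1 + 1))⁻¹) *
        ∑' w : Site (d + 1), ρ w * ∑' t : Site (d + 1), (if t ν % (Lc : ℤ) = (Lc : ℤ) - 1 then S ν t z w f g else 0) := by
  obtain ⟨δK, CK, hδK, hCK, hXd⟩ := decays_coDressKBmAt hLc hr (decays_KInvStep (d := d) (Lc := Lc) J)
  have hXu := decays_unitK (sf := sf) (sm := sm) hXd
  have hCX : 0 ≤ max |sf| |sm| * CK * max |sf| |sm| := by positivity
  have hCs : 0 ≤ Cs := (hS 0 0).nonneg (Sum.inl 0)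
  set δ₁ : ℝ := min δK δs with hδ₁
  have hδ₁0 : 0 < δ₁ := lt_min hδK hδs
  have hX1 : Decays (unitK sf sm (coDressKBmAt (toSite r) Lc (KInvStep (d := d) Lc J))) (max |sf| |sm| * CK * max |sf| |sm|) δ₁ := decays_mono hXu hCX le_rfl (min_le_left _ _)
  have hS1 : LocStencil S Cs δ₁ := fun κ u => biLoc_mono (hS κ u) hCs (min_le_right _ _)
  have hV := vertexFamily_vertexOfK (N := Lc) hX1 hCX hS1 hδ₁0 le_rfl
  rw [tsum_prod_weight_eq_iterated hLc hV (half_pos hδ₁0) hρ ν z f g, ← tsum_mul_left]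
  refine tsum_congr fun w => ?_
  rw [(hasSum_vertexOfK_dressedStep hLc hr sf sm J ν hS hδs z w f g).tsum_eq]
  ring

end Resum

/-! ## §2 The constant-slot sum: fine covariance, the shifted cell sum, the (slot + second leg) zero -/

section SlotSum

variable {S : Fin (d + 1) → Site (d + 1) → MKer (d + 1) (Fib d)} {Cs δs : ℝ}

omit [NeZero Lc] in
/-- [folklore] For a local stencil family the `(slot, second leg)` family at a fixed first leg is absolutely summable. -/
theorem summable_prod_slot_leg (hS : LocStencil S Cs δs) (hδs : 0 < δs) (ν : Fin (d + 1)) (z : Site (d + 1)) (f g : Fib d) :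
    Summable fun tw : Site (d + 1) × Site (d + 1) => |S ν tw.1 z tw.2 f g| := by
  have hCs : 0 ≤ Cs := (hS ν 0).nonneg f
  set M : Site (d + 1) × Site (d + 1) → ℝ := fun tw => Cs * Real.exp (-δs * l1 (z - tw.1)) * Real.exp (-δs * l1 (tw.2 - tw.1)) with hM
  have hM0 : 0 ≤ M := fun tw => by positivity
  have hMs : Summable M := by
    refine (summable_prod_of_nonneg hM0).2 ⟨fun t => ?_, ?_⟩
    · exact (summable_exp_shift' hδs t).mul_left (Cs * Real.exp (-δs * l1 (z - t)))
    · have e : ∀ t : Site (d + 1), ∑' w : Site (d + 1), M (t, w) = Cs * Real.exp (-δs * l1 (z - t)) * Zl (d + 1) δs := by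
        intro t
        simp only [hM]
        rw [tsum_mul_left, tsum_exp_shift']
      refine (((ExpKernelCalculus.summable_exp_shift hδs z).mul_left Cs).mul_right (Zl (d + 1) δs)).congr fun t => ?_
      rw [e]
  refine Summable.of_nonneg_of_le (fun _ => abs_nonneg _) (fun tw => ?_) hMs
  have h := hS ν tw.1 z tw.2 f g
  rw [mul_add, Real.exp_add, ← mul_assoc] at h
  exact h

omit [NeZero Lc] in
/-- [folklore] **FINE COVARIANCE OF THE CONSTANT-SLOT SUM**: for `S κ (t + v) = shiftK (−v) (S κ t)`, `A(z + v, w + v) = A(z, w)` with `A(z,w) = Σ'_t S ν t z w f g`. -/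
theorem slotSum_translate (hScov : ∀ (κ : Fin (d + 1)) (t v : Site (d + 1)), S κ (t + v) = shiftK (-v) (S κ t)) (ν : Fin (d + 1)) (z w v : Site (d + 1)) (f g : Fib d) :
    ∑' t : Site (d + 1), S ν t (z + v) (w + v) f g = ∑' t : Site (d + 1), S ν t z w f g := by
  rw [← (Equiv.addRight v).tsum_eq (fun t : Site (d + 1) => S ν t (z + v) (w + v) f g)]
  refine tsum_congr fun t => ?_
  simp only [Equiv.coe_addRight, hScov ν t v, shiftK]
  congr 1 <;> abel

omit [NeZero Lc] in
/-- [folklore] The shifted family `k ↦ ρ(z + k)·A(0, k)` is summable for a bounded weight (absolute summability of the `(slot, leg)` family at first leg `0`). -/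
theorem summable_slotSum_shift (hS : LocStencil S Cs δs) (hδs : 0 < δs) {ρ : Site (d + 1) → ℝ} (hρ : ∀ w, |ρ w| ≤ 1) (ν : Fin (d + 1)) (z : Site (d + 1)) (f g : Fib d) :
    Summable fun k : Site (d + 1) => ρ (z + k) * ∑' t : Site (d + 1), S ν t 0 k f g := by
  have hs := summable_prod_slot_leg hS hδs ν 0 f g
  have hs' : Summable fun kt : Site (d + 1) × Site (d + 1) => |S ν kt.2 0 kt.1 f g| :=
    ((Equiv.prodComm (Site (d + 1)) (Site (d + 1))).summable_iff.2 hs).congr fun kt => by simp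
  have hk : Summable fun k : Site (d + 1) => ∑' t : Site (d + 1), |S ν t 0 k f g| := hs'.prod
  refine Summable.of_norm_bounded hk (fun k => ?_)
  have hst : Summable fun t : Site (d + 1) => ‖S ν t 0 k f g‖ := (hs'.prod_factor k).congr fun t => (Real.norm_eq_abs _).symm
  have h1 : |∑' t : Site (d + 1), S ν t 0 k f g| ≤ ∑' t : Site (d + 1), |S ν t 0 k f g| := by
    have h := norm_tsum_le_tsum_norm hst
    simpa only [Real.norm_eq_abs] using h
  rw [Real.norm_eq_abs, abs_mul]
  calc |ρ (z + k)| * |∑' t : Site (d + 1), S ν t 0 k f g| ≤ 1 * ∑' t : Site (d + 1), |S ν t 0 k f g| :=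
        mul_le_mul (hρ _) h1 (abs_nonneg _) zero_le_one
    _ = _ := one_mul _

/-- [folklore] **THE CELL SUM OF THE FACE-WEIGHTED CONSTANT-SLOT SUM VANISHES**: for a local, fine-covariant `S` whose (slot + second leg) constant sum vanishes at the first leg `0`
(`hS3 : HasSum ((t,w) ↦ S ν t 0 w f g) 0` — my g63 S3C-REC (iii)) and an `Lc`-periodic weight `|ρ| ≤ 1`:
`Σ_{z∈box Lc} Σ'_w ρ(w)·Σ'_t S ν t (toSite z) w f g = 0`. -/
theorem sum_box_tsum_face_slotSum_eq_zero (hS : LocStencil S Cs δs) (hδs : 0 < δs)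
    (hScov : ∀ (κ : Fin (d + 1)) (t v : Site (d + 1)), S κ (t + v) = shiftK (-v) (S κ t)) (ν : Fin (d + 1)) (f g : Fib d)
    (hS3 : HasSum (fun tw : Site (d + 1) × Site (d + 1) => S ν tw.1 0 tw.2 f g) 0)
    {ρ : Site (d + 1) → ℝ} (hρ : ∀ w, |ρ w| ≤ 1) (hρp : IsPeriodic Lc ρ) :
    ∑ z ∈ box (d + 1) Lc, ∑' w : Site (d + 1), ρ w * ∑' t : Site (d + 1), S ν t (toSite z) w f g = 0 := by
  -- re-centre the leg: `w = z + k`, `A(z, z + k) = A(0, k)`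
  have e1 : ∀ z : Site (d + 1), ∑' w : Site (d + 1), ρ w * ∑' t : Site (d + 1), S ν t z w f g =
      ∑' k : Site (d + 1), ρ (z + k) * ∑' t : Site (d + 1), S ν t 0 k f g := by
    intro z
    rw [← (Equiv.addLeft z).tsum_eq (fun w : Site (d + 1) => ρ w * ∑' t : Site (d + 1), S ν t z w f g)]
    refine tsum_congr fun k => ?_
    simp only [Equiv.coe_addLeft]
    congr 1
    have h := slotSum_translate hScov ν 0 k z f g
    rw [zero_add, add_comm k z] at h
    exact h
  simp only [e1]
  rw [← Summable.tsum_finsetSum (fun z _ => summable_slotSum_shift hS hδs hρ ν (toSite z) f g)]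
  have e2 : ∀ k : Site (d + 1), ∑ z ∈ box (d + 1) Lc, ρ (toSite z + k) * ∑' t : Site (d + 1), S ν t 0 k f g =
      (∑ z ∈ box (d + 1) Lc, ρ (toSite z)) * ∑' t : Site (d + 1), S ν t 0 k f g := by
    intro k
    rw [← Finset.sum_mul, sum_box_shift hρp k]
  rw [tsum_congr e2, tsum_mul_left]
  -- the (slot + second leg) sum at first leg `0`
  have hs := summable_prod_slot_leg hS hδs ν 0 f g
  have hs' : Summable fun kt : Site (d + 1) × Site (d + 1) => |S ν kt.2 0 kt.1 f g| :=
    ((Equiv.prodComm (Site (d + 1)) (Site (d + 1))).summable_iff.2 hs).congr fun kt => by simp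
  have hsum : Summable fun kt : Site (d + 1) × Site (d + 1) => S ν kt.2 0 kt.1 f g :=
    Summable.of_norm_bounded hs' (fun kt => by rw [Real.norm_eq_abs])
  have hval : ∑' kt : Site (d + 1) × Site (d + 1), S ν kt.2 0 kt.1 f g = 0 := by
    rw [← (Equiv.prodComm (Site (d + 1)) (Site (d + 1))).tsum_eq (fun kt : Site (d + 1) × Site (d + 1) => S ν kt.2 0 kt.1 f g)]
    simp only [Equiv.prodComm_apply, Prod.fst_swap, Prod.snd_swap]
    exact hS3.tsum_eq
  rw [← hsum.tsum_prod, hval, mul_zero]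

end SlotSum

/-! ## §3 The cell totals of the face-summed-slot current -/

section CellTotals

variable {S : Fin (d + 1) → Site (d + 1) → MKer (d + 1) (Fib d)} {Cs δs : ℝ}

/-- [folklore] **THE CELL TOTALS OF THE EXIT-FACE CURRENT VANISH** (generic form).  `S` local and fine-covariant; the face-summed slot splits (`hsplit`) into `Lc⁻¹×` the
constant-slot sum minus `(2Lc)⁻¹×` a kernel entry `E(z,w)` times `λ(w) − λ(z)` with `λ` bounded; the (slot + second leg) constant sum vanishes (`hS3`); the rows of `E` are
absolutely summable (`hErow`), kill the exit-face weight (`hEface`) and satisfy the cell adjointness against the periodic bounded weight `χ_β·λ` with vanishing column sums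
(`hEadj0`): then `Σ_{z∈box Lc} Σ'_w χ_β(w)·Σ'_t χ_ν(t)·S ν t (toSite z) w (inl b)(inl β) = 0`. -/
theorem sum_box_faceSlot_current_eq_zero (hS : LocStencil S Cs δs) (hδs : 0 < δs)
    (hScov : ∀ (κ : Fin (d + 1)) (t v : Site (d + 1)), S κ (t + v) = shiftK (-v) (S κ t)) (ν b β : Fin (d + 1))
    {E : Site (d + 1) → Site (d + 1) → ℝ} {lam : Site (d + 1) → ℝ} {Λ : ℝ} (hlam : ∀ w, |lam w| ≤ Λ)
    (hsplit : ∀ z w : Site (d + 1), ∑' t : Site (d + 1), (if t ν % (Lc : ℤ) = (Lc : ℤ) - 1 then S ν t z w (Sum.inl b) (Sum.inl β) else 0) =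
      (Lc : ℝ)⁻¹ * (∑' t : Site (d + 1), S ν t z w (Sum.inl b) (Sum.inl β)) - (2 * (Lc : ℝ))⁻¹ * (E z w * (lam w - lam z)))
    (hS3 : HasSum (fun tw : Site (d + 1) × Site (d + 1) => S ν tw.1 0 tw.2 (Sum.inl b) (Sum.inl β)) 0)
    (hErow : ∀ z : Site (d + 1), Summable fun w => |E z w|)
    (hEface : ∀ z : Site (d + 1), ∑' w : Site (d + 1), E z w * (if w β % (Lc : ℤ) = (Lc : ℤ) - 1 then (1 : ℝ) else 0) = 0)
    (hEadj0 : ∑ z ∈ box (d + 1) Lc, ∑' w : Site (d + 1), E (toSite z) w * ((if w β % (Lc : ℤ) = (Lc : ℤ) - 1 then (1 : ℝ) else 0) * lam w) = 0) :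
    ∑ z ∈ box (d + 1) Lc, ∑' w : Site (d + 1), (if w β % (Lc : ℤ) = (Lc : ℤ) - 1 then (1 : ℝ) else 0) *
        ∑' t : Site (d + 1), (if t ν % (Lc : ℤ) = (Lc : ℤ) - 1 then S ν t (toSite z) w (Sum.inl b) (Sum.inl β) else 0) = 0 := by
  have hΛ : 0 ≤ Λ := (abs_nonneg _).trans (hlam 0)
  have hχ : ∀ w : Site (d + 1), |(if w β % (Lc : ℤ) = (Lc : ℤ) - 1 then (1 : ℝ) else 0)| ≤ 1 := fun w => by split_ifs <;> simp
  have hχp : IsPeriodic Lc (fun w : Site (d + 1) => (if w β % (Lc : ℤ) = (Lc : ℤ) - 1 then (1 : ℝ) else 0)) := by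
    intro w s
    simp only [Pi.add_apply, Pi.smul_apply, smul_eq_mul, Int.add_mul_emod_self_left]
  -- summability of the three `w`-families at each `z`
  have hA : ∀ z : Site (d + 1), Summable fun w : Site (d + 1) => (if w β % (Lc : ℤ) = (Lc : ℤ) - 1 then (1 : ℝ) else 0) * ∑' t : Site (d + 1), S ν t z w (Sum.inl b) (Sum.inl β) := by
    intro z
    have h := summable_slotSum_shift hS hδs hχ ν z (Sum.inl b) (Sum.inl β)
    refine (Equiv.addLeft z).summable_iff.1 ?_
    refine h.congr fun k => ?_
    simp only [Function.comp_apply, Equiv.coe_addLeft]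
    congr 1
    have e := slotSum_translate hScov ν 0 k z (Sum.inl b) (Sum.inl β)
    rw [zero_add, add_comm k z] at e
    exact e.symm
  have hB1 : ∀ z : Site (d + 1), Summable fun w : Site (d + 1) => E z w * ((if w β % (Lc : ℤ) = (Lc : ℤ) - 1 then (1 : ℝ) else 0) * lam w) := by
    intro z
    refine Summable.of_norm_bounded ((hErow z).mul_right Λ) (fun w => ?_)
    rw [Real.norm_eq_abs, abs_mul, abs_mul]
    calc |E z w| * (|(if w β % (Lc : ℤ) = (Lc : ℤ) - 1 then (1 : ℝ) else 0)| * |lam w|) ≤ |E z w| * (1 * Λ) :=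
          mul_le_mul_of_nonneg_left (mul_le_mul (hχ w) (hlam w) (abs_nonneg _) zero_le_one) (abs_nonneg _)
      _ = |E z w| * Λ := by ring
  have hB2 : ∀ z : Site (d + 1), Summable fun w : Site (d + 1) => E z w * (if w β % (Lc : ℤ) = (Lc : ℤ) - 1 then (1 : ℝ) else 0) := by
    intro z
    refine Summable.of_norm_bounded (hErow z) (fun w => ?_)
    rw [Real.norm_eq_abs, abs_mul]
    calc |E z w| * |(if w β % (Lc : ℤ) = (Lc : ℤ) - 1 then (1 : ℝ) else 0)| ≤ |E z w| * 1 := mul_le_mul_of_nonneg_left (hχ w) (abs_nonneg _)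
      _ = |E z w| := mul_one _
  -- split each `z`-term
  have e : ∀ z : Site (d + 1), ∑' w : Site (d + 1), (if w β % (Lc : ℤ) = (Lc : ℤ) - 1 then (1 : ℝ) else 0) *
      ∑' t : Site (d + 1), (if t ν % (Lc : ℤ) = (Lc : ℤ) - 1 then S ν t z w (Sum.inl b) (Sum.inl β) else 0) =
      (Lc : ℝ)⁻¹ * ∑' w : Site (d + 1), (if w β % (Lc : ℤ) = (Lc : ℤ) - 1 then (1 : ℝ) else 0) * ∑' t : Site (d + 1), S ν t z w (Sum.inl b) (Sum.inl β)
        - (2 * (Lc : ℝ))⁻¹ * ∑' w : Site (d + 1), E z w * ((if w β % (Lc : ℤ) = (Lc : ℤ) - 1 then (1 : ℝ) else 0) * lam w)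
        + (2 * (Lc : ℝ))⁻¹ * lam z * ∑' w : Site (d + 1), E z w * (if w β % (Lc : ℤ) = (Lc : ℤ) - 1 then (1 : ℝ) else 0) := by
    intro z
    have es : ∀ w : Site (d + 1), (if w β % (Lc : ℤ) = (Lc : ℤ) - 1 then (1 : ℝ) else 0) *
        ∑' t : Site (d + 1), (if t ν % (Lc : ℤ) = (Lc : ℤ) - 1 then S ν t z w (Sum.inl b) (Sum.inl β) else 0) =
        (Lc : ℝ)⁻¹ * ((if w β % (Lc : ℤ) = (Lc : ℤ) - 1 then (1 : ℝ) else 0) * ∑' t : Site (d + 1), S ν t z w (Sum.inl b) (Sum.inl β))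
          - (2 * (Lc : ℝ))⁻¹ * (E z w * ((if w β % (Lc : ℤ) = (Lc : ℤ) - 1 then (1 : ℝ) else 0) * lam w))
          + (2 * (Lc : ℝ))⁻¹ * lam z * (E z w * (if w β % (Lc : ℤ) = (Lc : ℤ) - 1 then (1 : ℝ) else 0)) := by
      intro w
      rw [hsplit z w]
      ring
    rw [tsum_congr es, (((hA z).mul_left _).sub ((hB1 z).mul_left _)).tsum_add ((hB2 z).mul_left _),
      ((hA z).mul_left _).tsum_sub ((hB1 z).mul_left _), tsum_mul_left, tsum_mul_left, tsum_mul_left]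
  simp only [e, hEface, mul_zero, add_zero]
  rw [Finset.sum_sub_distrib, ← Finset.mul_sum, ← Finset.mul_sum,
    sum_box_tsum_face_slotSum_eq_zero hS hδs hScov ν (Sum.inl b) (Sum.inl β) hS3 hχ hχp, hEadj0, mul_zero, mul_zero, sub_zero]

end CellTotals

end Summit.QuantumFields.BalabanUV.Beta.GAN24.ExitFaceCurrentCellTotals

end
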